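import Mathlib.GroupTheory.Transfer
import Mathlib.Algebra.BigOperators.Fin
import HarnessLib

/-!
# Orbits of a cyclic subgroup on a coset space and double cosets: the sheets-over-a-cusp dictionary

Topic `Literature/GroupTheory/CombinatorialGroupTheory`; theorems only, Mathlib-only.  For a subgroup
`K ≤ G` of finite index and an element `c ∈ G`, the cyclic group `⟨c⟩` acts on the finite coset space
`G/K`; Mathlib's transfer-transversal machinery (`Subgroup.quotientEquivSigmaZMod`) decomposes `G/K` into
the `⟨c⟩`-orbits `ω ∈ Ω := orbitRel.Quotient ⟨c⟩ (G/K)`, the orbit of `ω` being a cycle of length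
`m_ω = minimalPeriod (c • ·) ω.out`.  Writing `rep ω := (ω.out.out)⁻¹ ∈ G` (so that `(rep ω)⁻¹ K` is a
coset in the orbit), this file records the classical dictionary (covering-space language: the cusps of
the `[G : K]`-sheeted covering lying over the cusp `c`, with their ramification indices — Hoare–Karrass–
Solitar, *Subgroups of finite index of Fuchsian groups*, Math. Z. 120 (1971), proof of Thm 1;
Zieschang–Vogt–Coldewey, LNM 835, §4.14, 4.14.1–4.14.3):

* `minimalPeriod_pos'` — `0 < m_ω`;
* `rep_mul_zpow_mul_inv_mem_iff` — `rep ω · cⁿ · (rep ω)⁻¹ ∈ K ↔ m_ω ∣ n` (the stabiliser of a sheet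
  over the cusp is generated by `c^{m_ω}`);
* `existsUnique_orbit_rep_mem_doubleCoset` — for every `δ ∈ G` there is EXACTLY ONE orbit `ω` with
  `rep ω ∈ K · δ · ⟨c⟩` (orbits `↔` double cosets `K \ G / ⟨c⟩`);
* `sum_minimalPeriod_eq_index` — `Σ_ω m_ω = [G : K]` (the ramification indices over a cusp add up to
  the number of sheets).

Consumer: the (S) "Schreier ribbon graph" layer of the cell's Riemann–Hurwitz-with-cusps theorem for
punctured surface groups (`PuncturedSurfaceGroupFiniteIndexSubgroup`, GT-A), instantiated face by face
with `c = ` the boundary word of a face.  No definitions: `rep ω` is spelled `(ω.out.out)⁻¹` throughout.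
-/

namespace Literature.GroupTheory.CombinatorialGroupTheory

namespace CosetOrbits

open MulAction Subgroup Function

universe u

variable {G : Type u} [Group G] (K : Subgroup G) (c : G)

/-- The coset represented by `ω.out.out` is `ω.out`, a point of the orbit `ω`.
[cite: ZieschangVogtColdewey1980, Thm 4.14.1 p.150] -/
theorem mk_out_out (ω : orbitRel.Quotient (zpowers c) (G ⧸ K)) :
    ((Quotient.out ω).out : G ⧸ K) = Quotient.out ω :=
  Quotient.out_eq _

/-- `c^n` fixes the coset `x K` iff `x⁻¹ cⁿ x ∈ K`. [cite: ZieschangVogtColdewey1980, Thm 4.14.1 p.150] -/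
theorem zpow_smul_coe_eq_iff (x : G) (n : ℤ) :
    c ^ n • (x : G ⧸ K) = (x : G ⧸ K) ↔ x⁻¹ * c ^ n * x ∈ K := by
  rw [MulAction.Quotient.smul_coe, QuotientGroup.eq, smul_eq_mul]
  have h1 : (c ^ n * x)⁻¹ * x = (x⁻¹ * c ^ n * x)⁻¹ := by group
  rw [h1, Subgroup.inv_mem_iff]

/-- **Ramification index is positive**: the `⟨c⟩`-orbit of a coset is a finite cycle (`K` of finite
index), so `0 < m_ω`. [cite: ZieschangVogtColdewey1980, Thm 4.14.1 p.150] -/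
theorem minimalPeriod_pos' [K.FiniteIndex] (q : G ⧸ K) : 0 < minimalPeriod (c • ·) q := by
  haveI : Finite (G ⧸ K) := finite_quotient_of_finiteIndex
  exact Nat.pos_of_neZero _

/-- **The stabiliser of a sheet over the cusp**: with `rep ω = (ω.out.out)⁻¹`,
`rep ω · cⁿ · (rep ω)⁻¹ ∈ K ↔ (m_ω : ℤ) ∣ n`, `m_ω = minimalPeriod (c • ·) ω.out`.
[cite: ZieschangVogtColdewey1980, Thm 4.14.1 p.150] -/
theorem rep_mul_zpow_mul_inv_mem_iff (ω : orbitRel.Quotient (zpowers c) (G ⧸ K)) (n : ℤ) :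
    ((Quotient.out ω).out)⁻¹ * c ^ n * ((Quotient.out ω).out)⁻¹⁻¹ ∈ K ↔
      (minimalPeriod (c • ·) (Quotient.out ω) : ℤ) ∣ n := by
  rw [inv_inv, ← zpow_smul_coe_eq_iff K c, mk_out_out, MulAction.zpow_smul_eq_iff_minimalPeriod_dvd]

/-- Existence for the double-coset dictionary: the orbit of the coset `δ⁻¹ K` has a representative in
`K · δ · ⟨c⟩`. [cite: ZieschangVogtColdewey1980, Thm 4.14.1 p.150] -/
theorem exists_orbit_rep_mem_doubleCoset (δ : G) :
    ∃ ω : orbitRel.Quotient (zpowers c) (G ⧸ K),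
      ∃ k ∈ K, ∃ z ∈ zpowers c, ((Quotient.out ω).out)⁻¹ = k * δ * z := by
  refine ⟨(Quotient.mk _ (δ⁻¹ : G) : orbitRel.Quotient (zpowers c) (G ⧸ K)), ?_⟩
  set ω : orbitRel.Quotient (zpowers c) (G ⧸ K) := Quotient.mk _ ((δ⁻¹ : G) : G ⧸ K) with hω
  -- `ω.out` lies in the orbit of `δ⁻¹ K`
  have hrel : (orbitRel (zpowers c) (G ⧸ K)) (Quotient.out ω) ((δ⁻¹ : G) : G ⧸ K) :=
    Quotient.exact (by rw [Quotient.out_eq, hω])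
  obtain ⟨⟨z, hz⟩, hzq⟩ := orbitRel_apply.mp hrel
  -- `ω.out = z • δ⁻¹K = (z δ⁻¹) K`, so `ω.out.out = z δ⁻¹ k'` with `k' ∈ K`
  have h1 : ((Quotient.out ω).out : G ⧸ K) = ((z * δ⁻¹ : G) : G ⧸ K) := by
    rw [mk_out_out, ← hzq]
    change z • ((δ⁻¹ : G) : G ⧸ K) = _
    rw [MulAction.Quotient.smul_coe, smul_eq_mul]
  rw [QuotientGroup.eq] at h1
  -- `h1 : (ω.out.out)⁻¹ * (z δ⁻¹) ∈ K`
  refine ⟨((Quotient.out ω).out)⁻¹ * (z * δ⁻¹), h1, z⁻¹, (zpowers c).inv_mem hz, by group⟩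

/-- Uniqueness for the double-coset dictionary: two orbits with representatives in the same double
coset `K · δ · ⟨c⟩` coincide. [cite: ZieschangVogtColdewey1980, Thm 4.14.1 p.150] -/
theorem orbit_eq_of_rep_mem_doubleCoset {δ : G} {ω ω' : orbitRel.Quotient (zpowers c) (G ⧸ K)}
    (h : ∃ k ∈ K, ∃ z ∈ zpowers c, ((Quotient.out ω).out)⁻¹ = k * δ * z)
    (h' : ∃ k ∈ K, ∃ z ∈ zpowers c, ((Quotient.out ω').out)⁻¹ = k * δ * z) : ω = ω' := by
  obtain ⟨k, hk, z, hz, he⟩ := h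
  obtain ⟨k', hk', z', hz', he'⟩ := h'
  -- both `ω.out`, `ω'.out` lie in the orbit of `δ⁻¹ K`
  have hcoset : ∀ {x k z : G}, k ∈ K → x⁻¹ = k * δ * z →
      (x : G ⧸ K) = ((z⁻¹ * δ⁻¹ : G) : G ⧸ K) := by
    intro x k z hk he
    rw [QuotientGroup.eq]
    have hx : x = z⁻¹ * δ⁻¹ * k⁻¹ := by
      rw [← inv_inv x, he]; group
    rw [hx]
    have h2 : (z⁻¹ * δ⁻¹ * k⁻¹)⁻¹ * (z⁻¹ * δ⁻¹) = k := by group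
    rw [h2]
    exact hk
  have hmem : ∀ {x k z : G}, k ∈ K → z ∈ zpowers c → x⁻¹ = k * δ * z →
      (orbitRel (zpowers c) (G ⧸ K)) (x : G ⧸ K) ((δ⁻¹ : G) : G ⧸ K) := by
    intro x k z hk hz he
    rw [orbitRel_apply, hcoset hk he]
    refine ⟨⟨z⁻¹, (zpowers c).inv_mem hz⟩, ?_⟩
    change z⁻¹ • ((δ⁻¹ : G) : G ⧸ K) = _
    rw [MulAction.Quotient.smul_coe, smul_eq_mul]
  have h1 := hmem hk hz he
  have h2 := hmem hk' hz' he'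
  rw [mk_out_out] at h1 h2
  rw [← Quotient.out_eq ω, ← Quotient.out_eq ω']
  exact Quotient.sound ((orbitRel (zpowers c) (G ⧸ K)).trans h1 ((orbitRel (zpowers c) (G ⧸ K)).symm h2))

/-- **Orbits ↔ double cosets**: for every `δ ∈ G` there is exactly one `⟨c⟩`-orbit `ω` on `G/K` whose
representative `rep ω = (ω.out.out)⁻¹` lies in the double coset `K · δ · ⟨c⟩`.
[cite: ZieschangVogtColdewey1980, Thm 4.14.1 p.150] -/
theorem existsUnique_orbit_rep_mem_doubleCoset (δ : G) :
    ∃! ω : orbitRel.Quotient (zpowers c) (G ⧸ K),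
      ∃ k ∈ K, ∃ z ∈ zpowers c, ((Quotient.out ω).out)⁻¹ = k * δ * z := by
  obtain ⟨ω, hω⟩ := exists_orbit_rep_mem_doubleCoset K c δ
  exact ⟨ω, hω, fun ω' hω' => orbit_eq_of_rep_mem_doubleCoset K c hω' hω⟩

/-- **The ramification indices over a cusp add up to the number of sheets**:
`Σ_ω m_ω = [G : K]`. [cite: ZieschangVogtColdewey1980, 4.14.3 p.151] -/
theorem sum_minimalPeriod_eq_index [K.FiniteIndex]
    [Fintype (orbitRel.Quotient (zpowers c) (G ⧸ K))] :
    ∑ ω : orbitRel.Quotient (zpowers c) (G ⧸ K), minimalPeriod (c • ·) (Quotient.out ω) = K.index := by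
  classical
  letI := K.fintypeQuotientOfFiniteIndex
  haveI : ∀ ω : orbitRel.Quotient (zpowers c) (G ⧸ K),
      NeZero (minimalPeriod (c • ·) (Quotient.out ω)) := fun ω => ⟨(minimalPeriod_pos' K c _).ne'⟩
  rw [Subgroup.index_eq_card, Nat.card_eq_fintype_card,
    Fintype.card_congr (Subgroup.quotientEquivSigmaZMod K c), Fintype.card_sigma]
  refine Finset.sum_congr rfl fun ω _ => ?_
  rw [ZMod.card]

end CosetOrbits

end Literature.GroupTheory.CombinatorialGroupTheory
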